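import Summits.HodgeConjecture.HodgeConjecture.Theorems.K2E1MultiplicityOneU3DiscretePartCount   -- ★ p854795 (K2E1-p09): `multiplicity = #{W ∈ S | W ≃ σ}` on a decomposition of `L²_disc`
import HarnessLib

/-!
# K2·E1 — row 13 bookkeeping, brick B2 «SUM OVER A DECOMPOSITION OF `L²_disc` REGROUPED BY CLASSES»: `Σ_{W ∈ S} t(W) = Σ_{[π]} m(π) · t(π)`

Cell `hodgecm-mathlib`, Track B ∕ K2-LIT, squad K2, ENGINE E1 (line `K2_E1_TraceFormulaBeta`); crux H413 = `stmt-HodgeConjecture-24833` (route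
`HCCMUnconditional`); seat K2E1-p09 (g0), DEAL K2E1-plan (g0) 2026-09-03T21:31:08Z «B2 first».  PROOF FILE, lane `--supports stmt-HodgeConjecture-24833
--as helper`: THEOREMS ONLY — no definition, no instance, no notation, no named fact, no `sorry`.  Closes no socket.  HONEST LABEL: HC_CM is proved only
modulo the 7 printed citations (2 remaining named inputs: hLiu418 = `stmt-HodgeConjecture-24832`, h413 = `stmt-HodgeConjecture-24833`) until rung 0 closes;
nothing here changes that count.

WHAT.  The printed discrete-spectrum expansion [Rogawski1990, §13.6 (13.6.1) p. 208: «`Σ m(π) Tr(π(f))` where `π` ranges over the discrete automorphic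
representations»; Thm. 13.3.8 p. 203 «`Tr(ρ_d(f)) = Σ n(Π) Tr(Π(f)) + …`»] sums a CLASS FUNCTION `π ↦ Tr π(f)` over ISOMORPHISM CLASSES with the weights
`m(π)`; the Hilbert-space side (row 13, K2E1-p01's brick `K2E1OpTraceOrthogonalSum`: `Tr T = Σ_{W ∈ S} Tr (T|_W)` over an orthogonal decomposition
`L²_disc = ⊕̂_{W ∈ S} W`) sums over the MEMBERS of a decomposition.  This file is the regrouping between the two, in the tree's currency:

* §1 (any types; Theorems-side twin of the tier-0 workfile's `hasSum_fibreSum`, [Rogawski1990, §13.8 p. 219 «`a(π_w) = Σ_{π ↦ π_w} m(π) ε_π`»], with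
  COMPLEX weights and without a named `def`): `hasSum_fibrewise` — an absolutely convergent sum `Σ_i b(i)·T(p i)` regroups along a map `p : I → C` with finite
  fibres into `Σ_c (Σ_{p i = c} b(i))·T(c)`; `hasSum_fibrewise_natCard` — the unweighted case, coefficient `#p⁻¹(c)`.
* §2 (unitary `π` on a complex Hilbert space; `S` a set of pairwise orthogonal irreducible closed subrepresentations with closed span ★ `π.discretePart`; a
  CLASSIFYING MAP `p : S → C`, i.e. `p W = p W′ ↔ W ≃ W′` — e.g. the isomorphism class, the family of local classes `(π_u)_u`, an e.v.p.):
  `card_fibre_eq_multiplicity` — the fibre of `p` through `W₀` has `ENat.card = multiplicity π W₀` (★ `multiplicity_eq_card_of_discretePart`, [Dixmier1977,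
  5.4.6]); `finite_fibre_of_multiplicity_lt_top` — under FINITE MULTIPLICITIES (the row-3 shape ★ `multiplicity_lt_top_of_mem_discreteSpectrum`:
  `∀ W ∈ S, multiplicity π W < ⊤`) every fibre is finite, and `natCard_fibre_eq_multiplicity` (`(#fibre : ℕ∞) = multiplicity`);
  **`hasSum_classes_of_hasSum_members`** — `HasSum (W ↦ b W · T (p W)) s → HasSum (c ↦ (Σ_{p W = c} b W) · T c) s`, and **`hasSum_classes_mul_of_hasSum_members`**
  — the unweighted case `HasSum (W ↦ T (p W)) s → HasSum (c ↦ #p⁻¹(c) · T c) s` whose coefficient at `c = p W₀` IS `m(W₀) = multiplicity π W₀`: the printed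
  «`Σ_π m(π) Tr π(f)`».
* §3 (any ★ `AdelicGroupData`, automorphic `μ`, `S` a decomposition of ★ `𝒢.discreteSpectrum μ`) the same three statements for `L²(G(𝔸_K) ⧸ A_G G(K), μ)`.

With K2E1-p01's `HasSum (W ↦ opTrace (T|_W)) (opTrace T|_{L²_disc})` (brick (ii)) and B1 (`opTrace (T|_W)` depends only on the class of `W` for `T = R(f)`),
this gives «`Tr R_d(f) = Σ_{[π]} m(π) Tr π(f)`» for the concrete instance of ★ `SpectralTermsU3` (TABLE row 13).

References: [Rogawski1990] J. Rogawski, Ann. of Math. Stud. 123 (1990), §13.6 (13.6.1) p. 208, Thm. 13.3.8 p. 203, §13.8 p. 219.  [Dixmier1977] J. Dixmier,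
*C\*-algebras* (1977), §5.4 (5.4.6).  [BorelJacquet1979] A. Borel, H. Jacquet, PSPM 33.1 (1979), §4.6 («`L²_d = ⊕̂ m(π) π`, `m(π)` finite»).
-/

set_option autoImplicit false
-- the mandated namespace has the single-problem summit's repeated segment (`HodgeConjecture.HodgeConjecture`)
set_option linter.dupNamespace false

noncomputable section

namespace Summit.HodgeConjecture.HodgeConjecture.Cruxes.H413.K2E1DecompositionSumByClasses

open MeasureTheory NumberField
open scoped InnerProductSpace
open ContRepresentation
open Literature.NumberTheory.Automorphic
open Summit.HodgeConjecture.HodgeConjecture.Cruxes.H413.K2E1TraceFormulaBeta.MultiplicityOneU3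

universe u

/-! ## §1 Regrouping an absolutely convergent sum along a map with finite fibres -/

section Fibrewise

variable {I C : Type*} (p : I → C)

/-- **Regrouping by finite fibres, complex weights.**  If `p : I → C` has finite fibres and `Σ_i b(i) · T(p i)` has sum `s`, then
`Σ_c (Σ_{i : p i = c} b(i)) · T(c)` has sum `s` (Mathlib `Equiv.sigmaFiberEquiv`, `HasSum.sigma`, `hasSum_fintype`; the Theorems-side twin of the line's
`hasSum_fibreSum`, [Rogawski1990, §13.8 p. 219: «`Σ a(π_w) Tr(π_w(f_w))` … `a(π_w) ∈ ℤ`» with `a(π_w) = Σ_{π ↦ π_w} m(π) ε_π`]). [cite: Rogawski1990, §13.8 p. 219] -/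
theorem hasSum_fibrewise (hfin : ∀ c : C, {i : I | p i = c}.Finite) (b : I → ℂ) (T : C → ℂ) {s : ℂ}
    (h : HasSum (fun i : I => b i * T (p i)) s) :
    HasSum (fun c : C => (∑ i ∈ (hfin c).toFinset, b i) * T c) s := by
  classical
  have h1 : HasSum ((fun i : I => b i * T (p i)) ∘ (Equiv.sigmaFiberEquiv p)) s :=
    (Equiv.hasSum_iff (Equiv.sigmaFiberEquiv p)).mpr h
  refine h1.sigma (fun c => ?_)
  haveI : Fintype {i : I // p i = c} := (hfin c).fintype
  have e : (∑ i ∈ (hfin c).toFinset, b i) * T c = ∑ x : {i : I // p i = c}, b x.1 * T (p x.1) := by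
    rw [Finset.sum_mul, Finset.sum_subtype ((hfin c).toFinset) (p := fun i => p i = c) (fun i => by simp) (fun i => b i * T c)]
    exact Finset.sum_congr rfl (fun x _ => by rw [x.2])
  rw [e]
  exact hasSum_fintype _

/-- **Regrouping by finite fibres, unweighted**: if `Σ_i T(p i)` has sum `s` then `Σ_c #p⁻¹(c) · T(c)` has sum `s` (the fibre cardinality as a natural
number, `Nat.card`). [cite: Rogawski1990, §13.6 (13.6.1) p. 208] -/
theorem hasSum_fibrewise_natCard (hfin : ∀ c : C, {i : I | p i = c}.Finite) (T : C → ℂ) {s : ℂ} (h : HasSum (fun i : I => T (p i)) s) :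
    HasSum (fun c : C => (Nat.card {i : I // p i = c} : ℂ) * T c) s := by
  classical
  have h' : HasSum (fun i : I => (1 : ℂ) * T (p i)) s := by simpa only [one_mul] using h
  have key := hasSum_fibrewise p hfin (fun _ => (1 : ℂ)) T h'
  convert key using 2 with c
  rw [Finset.sum_const, nsmul_eq_mul, mul_one]
  congr 1
  exact_mod_cast Nat.card_eq_card_finite_toFinset (hfin c)

end Fibrewise

/-! ## §2 Decompositions of the discrete part of a unitary representation: fibres of a classifying map are multiplicity-sized -/

section Decomposition

variable {G H : Type*} [Group G] [NormedAddCommGroup H] [InnerProductSpace ℂ H] [CompleteSpace H] {π : ContRepresentation ℂ G H}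
  {S : Set (ClosedSubrep π)} {C : Type*}

/-- **The fibre of a classifying map through `W₀` has `multiplicity π W₀` members.**  Let `π` be unitary, `S` a set of pairwise orthogonal irreducible
closed subrepresentations with closed span `π.discretePart`, and `p : S → C` a CLASSIFYING map (`p W = p W′ ↔ W ≃ W′` unitarily).  Then for `W₀ ∈ S`,
`ENat.card {W ∈ S | p W = p W₀} = multiplicity π W₀` (★ `multiplicity_eq_card_of_discretePart`). [cite: Dixmier1977, 5.4.6] -/
theorem card_fibre_eq_multiplicity (hπ : π.IsUnitary) (hirr : ∀ W ∈ S, W.toContRep.IsTopIrreducible)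
    (horth : S.Pairwise fun W W' => W.toSubmodule ⟂ W'.toSubmodule) (hspan : ClosedSubrep.iSupClosure S = π.discretePart)
    (p : S → C) (hp : ∀ W W' : S, p W = p W' ↔ AreUnitarilyEquivalent (W : ClosedSubrep π).toContRep (W' : ClosedSubrep π).toContRep) (W₀ : S) :
    ENat.card {W : S // p W = p W₀} = π.multiplicity (W₀ : ClosedSubrep π).toContRep := by
  rw [multiplicity_eq_card_of_discretePart hπ hirr horth hspan]
  exact ENat.card_congr (Equiv.subtypeEquivRight fun W => hp W W₀)

/-- **Finite multiplicities ⇒ finite fibres.**  With `π`, `S`, `p` as above, if every member of `S` has finite multiplicity in `π` (the shape of ★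
`multiplicity_lt_top_of_mem_discreteSpectrum`, [BorelJacquet1979, §4.6]) then every fibre of `p` is finite. [cite: BorelJacquet1979, §4.6]
[cite: Dixmier1977, 5.4.6] -/
theorem finite_fibre_of_multiplicity_lt_top (hπ : π.IsUnitary) (hirr : ∀ W ∈ S, W.toContRep.IsTopIrreducible)
    (horth : S.Pairwise fun W W' => W.toSubmodule ⟂ W'.toSubmodule) (hspan : ClosedSubrep.iSupClosure S = π.discretePart)
    (p : S → C) (hp : ∀ W W' : S, p W = p W' ↔ AreUnitarilyEquivalent (W : ClosedSubrep π).toContRep (W' : ClosedSubrep π).toContRep)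
    (hfin : ∀ W ∈ S, π.multiplicity W.toContRep < ⊤) (c : C) : {W : S | p W = c}.Finite := by
  by_cases hc : ∃ W₀ : S, p W₀ = c
  · obtain ⟨W₀, rfl⟩ := hc
    have hlt := hfin (W₀ : ClosedSubrep π) W₀.2
    rw [← card_fibre_eq_multiplicity hπ hirr horth hspan p hp W₀, ENat.card_lt_top] at hlt
    exact Set.finite_coe_iff.mp hlt
  · push Not at hc
    convert Set.finite_empty
    exact Set.eq_empty_of_forall_notMem fun W hW => hc W hW

/-- The fibre cardinality as a natural number is the multiplicity: `(Nat.card {W ∈ S | p W = p W₀} : ℕ∞) = multiplicity π W₀` under finite multiplicities.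
[cite: Dixmier1977, 5.4.6] [cite: BorelJacquet1979, §4.6] -/
theorem natCard_fibre_eq_multiplicity (hπ : π.IsUnitary) (hirr : ∀ W ∈ S, W.toContRep.IsTopIrreducible)
    (horth : S.Pairwise fun W W' => W.toSubmodule ⟂ W'.toSubmodule) (hspan : ClosedSubrep.iSupClosure S = π.discretePart)
    (p : S → C) (hp : ∀ W W' : S, p W = p W' ↔ AreUnitarilyEquivalent (W : ClosedSubrep π).toContRep (W' : ClosedSubrep π).toContRep)
    (hfin : ∀ W ∈ S, π.multiplicity W.toContRep < ⊤) (W₀ : S) :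
    (Nat.card {W : S // p W = p W₀} : ℕ∞) = π.multiplicity (W₀ : ClosedSubrep π).toContRep := by
  haveI : Finite {W : S // p W = p W₀} := Set.finite_coe_iff.mpr (finite_fibre_of_multiplicity_lt_top hπ hirr horth hspan p hp hfin (p W₀))
  haveI : Fintype {W : S // p W = p W₀} := Fintype.ofFinite _
  rw [← card_fibre_eq_multiplicity hπ hirr horth hspan p hp W₀, ENat.card_eq_coe_fintype_card, Nat.card_eq_fintype_card]

/-- **`Σ_{W ∈ S} b(W)·T([W]) = Σ_{[π]} (Σ_{W ↦ [π]} b(W))·T([π])`** — regrouping an absolutely convergent weighted sum over the members of a decomposition of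
the discrete part along a classifying map, under finite multiplicities. [cite: Rogawski1990, §13.8 p. 219] [cite: Dixmier1977, 5.4.6] -/
theorem hasSum_classes_of_hasSum_members (hπ : π.IsUnitary) (hirr : ∀ W ∈ S, W.toContRep.IsTopIrreducible)
    (horth : S.Pairwise fun W W' => W.toSubmodule ⟂ W'.toSubmodule) (hspan : ClosedSubrep.iSupClosure S = π.discretePart)
    (p : S → C) (hp : ∀ W W' : S, p W = p W' ↔ AreUnitarilyEquivalent (W : ClosedSubrep π).toContRep (W' : ClosedSubrep π).toContRep)
    (hfin : ∀ W ∈ S, π.multiplicity W.toContRep < ⊤) (b : S → ℂ) (T : C → ℂ) {s : ℂ}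
    (h : HasSum (fun W : S => b W * T (p W)) s) :
    HasSum (fun c : C => (∑ W ∈ (finite_fibre_of_multiplicity_lt_top hπ hirr horth hspan p hp hfin c).toFinset, b W) * T c) s :=
  hasSum_fibrewise p (finite_fibre_of_multiplicity_lt_top hπ hirr horth hspan p hp hfin) b T h

/-- **«`Σ_π m(π) Tr π(f)`»: `Σ_{W ∈ S} T([W]) = Σ_c #p⁻¹(c) · T(c)`, the coefficient at `c = [W₀]` being `m(W₀) = multiplicity π W₀`** (`natCard_fibre_eq_multiplicity`;
`#p⁻¹(c) = 0` off the classes met by `S`).  The printed discrete-spectrum expansion [Rogawski1990, §13.6 (13.6.1) p. 208; Thm. 13.3.8 p. 203] read on an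
orthogonal decomposition `L²_disc = ⊕̂_{W ∈ S} W`, for any class function `T` (there: `T([π]) = Tr π(f)`). [cite: Rogawski1990, §13.6 (13.6.1) p. 208]
[cite: Dixmier1977, 5.4.6] [cite: BorelJacquet1979, §4.6] -/
theorem hasSum_classes_mul_of_hasSum_members (hπ : π.IsUnitary) (hirr : ∀ W ∈ S, W.toContRep.IsTopIrreducible)
    (horth : S.Pairwise fun W W' => W.toSubmodule ⟂ W'.toSubmodule) (hspan : ClosedSubrep.iSupClosure S = π.discretePart)
    (p : S → C) (hp : ∀ W W' : S, p W = p W' ↔ AreUnitarilyEquivalent (W : ClosedSubrep π).toContRep (W' : ClosedSubrep π).toContRep)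
    (hfin : ∀ W ∈ S, π.multiplicity W.toContRep < ⊤) (T : C → ℂ) {s : ℂ} (h : HasSum (fun W : S => T (p W)) s) :
    HasSum (fun c : C => (Nat.card {W : S // p W = c} : ℂ) * T c) s :=
  hasSum_fibrewise_natCard p (finite_fibre_of_multiplicity_lt_top hπ hirr horth hspan p hp hfin) T h

/-- The `tsum` form: `∑' W : S, T (p W) = ∑' c, #p⁻¹(c) · T c` when the left-hand side is summable (finite multiplicities). [cite: Rogawski1990, §13.6 (13.6.1) p. 208]
[cite: Dixmier1977, 5.4.6] -/
theorem tsum_members_eq_tsum_classes (hπ : π.IsUnitary) (hirr : ∀ W ∈ S, W.toContRep.IsTopIrreducible)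
    (horth : S.Pairwise fun W W' => W.toSubmodule ⟂ W'.toSubmodule) (hspan : ClosedSubrep.iSupClosure S = π.discretePart)
    (p : S → C) (hp : ∀ W W' : S, p W = p W' ↔ AreUnitarilyEquivalent (W : ClosedSubrep π).toContRep (W' : ClosedSubrep π).toContRep)
    (hfin : ∀ W ∈ S, π.multiplicity W.toContRep < ⊤) (T : C → ℂ) (hT : Summable fun W : S => T (p W)) :
    ∑' W : S, T (p W) = ∑' c : C, (Nat.card {W : S // p W = c} : ℂ) * T c :=
  ((hasSum_classes_mul_of_hasSum_members hπ hirr horth hspan p hp hfin T hT.hasSum).tsum_eq).symm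

end Decomposition

/-! ## §3 `L²` of an adelic group datum: the same over a decomposition of `L²_disc` -/

section Adelic

variable {K : Type} [Field K] [NumberField K] {𝒢 : AdelicGroupData.{u} K} {μ : Measure 𝒢.automorphicQuotient} [𝒢.IsAutomorphicMeasure μ]
  {S : Set (ClosedSubrep (𝒢.rightRegular μ))} {C : Type*}

/-- **The fibre of a classifying map on a decomposition of `L²_disc` through `W₀` has `m(W₀)` members** (`ENat.card`), for any adelic group datum and
automorphic measure. [cite: Dixmier1977, 5.4.6] [cite: BorelJacquet1979, §4.6] -/
theorem card_fibre_eq_multiplicity_rightRegular (hirr : ∀ W ∈ S, W.toContRep.IsTopIrreducible)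
    (horth : S.Pairwise fun W W' => W.toSubmodule ⟂ W'.toSubmodule) (hspan : ClosedSubrep.iSupClosure S = 𝒢.discreteSpectrum μ)
    (p : S → C) (hp : ∀ W W' : S, p W = p W' ↔ AreUnitarilyEquivalent (W : ClosedSubrep (𝒢.rightRegular μ)).toContRep
      (W' : ClosedSubrep (𝒢.rightRegular μ)).toContRep) (W₀ : S) :
    ENat.card {W : S // p W = p W₀} = (𝒢.rightRegular μ).multiplicity (W₀ : ClosedSubrep (𝒢.rightRegular μ)).toContRep :=
  card_fibre_eq_multiplicity (𝒢.isUnitary_rightRegular μ) hirr horth hspan p hp W₀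

/-- **Finite multiplicities in `L²` ⇒ the classifying map of a decomposition of `L²_disc` has finite fibres.** [cite: BorelJacquet1979, §4.6] -/
theorem finite_fibre_rightRegular (hirr : ∀ W ∈ S, W.toContRep.IsTopIrreducible)
    (horth : S.Pairwise fun W W' => W.toSubmodule ⟂ W'.toSubmodule) (hspan : ClosedSubrep.iSupClosure S = 𝒢.discreteSpectrum μ)
    (p : S → C) (hp : ∀ W W' : S, p W = p W' ↔ AreUnitarilyEquivalent (W : ClosedSubrep (𝒢.rightRegular μ)).toContRep
      (W' : ClosedSubrep (𝒢.rightRegular μ)).toContRep)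
    (hfin : ∀ W ∈ S, (𝒢.rightRegular μ).multiplicity W.toContRep < ⊤) (c : C) : {W : S | p W = c}.Finite :=
  finite_fibre_of_multiplicity_lt_top (𝒢.isUnitary_rightRegular μ) hirr horth hspan p hp hfin c

/-- **«`Tr ρ_d(f) = Σ_π m(π) Tr π(f)`», the regrouping step**: for a decomposition `L²_disc = ⊕̂_{W ∈ S} W` with finite multiplicities, a classifying map `p` and
any class function `T`, `HasSum (W ↦ T (p W)) s → HasSum (c ↦ #p⁻¹(c) · T c) s`, the coefficient at `[W₀]` being `m(W₀) =` ★ `multiplicity`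
(`card_fibre_eq_multiplicity_rightRegular`). [cite: Rogawski1990, §13.6 (13.6.1) p. 208; Thm. 13.3.8 p. 203] [cite: BorelJacquet1979, §4.6] -/
theorem hasSum_classes_mul_rightRegular (hirr : ∀ W ∈ S, W.toContRep.IsTopIrreducible)
    (horth : S.Pairwise fun W W' => W.toSubmodule ⟂ W'.toSubmodule) (hspan : ClosedSubrep.iSupClosure S = 𝒢.discreteSpectrum μ)
    (p : S → C) (hp : ∀ W W' : S, p W = p W' ↔ AreUnitarilyEquivalent (W : ClosedSubrep (𝒢.rightRegular μ)).toContRep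
      (W' : ClosedSubrep (𝒢.rightRegular μ)).toContRep)
    (hfin : ∀ W ∈ S, (𝒢.rightRegular μ).multiplicity W.toContRep < ⊤) (T : C → ℂ) {s : ℂ} (h : HasSum (fun W : S => T (p W)) s) :
    HasSum (fun c : C => (Nat.card {W : S // p W = c} : ℂ) * T c) s :=
  hasSum_classes_mul_of_hasSum_members (𝒢.isUnitary_rightRegular μ) hirr horth hspan p hp hfin T h

/-- The weighted form over `L²_disc`: `HasSum (W ↦ b W · T (p W)) s → HasSum (c ↦ (Σ_{p W = c} b W) · T c) s` (weights `b`, e.g. signs `ε_π`).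
[cite: Rogawski1990, §13.8 p. 219] [cite: BorelJacquet1979, §4.6] -/
theorem hasSum_classes_rightRegular (hirr : ∀ W ∈ S, W.toContRep.IsTopIrreducible)
    (horth : S.Pairwise fun W W' => W.toSubmodule ⟂ W'.toSubmodule) (hspan : ClosedSubrep.iSupClosure S = 𝒢.discreteSpectrum μ)
    (p : S → C) (hp : ∀ W W' : S, p W = p W' ↔ AreUnitarilyEquivalent (W : ClosedSubrep (𝒢.rightRegular μ)).toContRep
      (W' : ClosedSubrep (𝒢.rightRegular μ)).toContRep)
    (hfin : ∀ W ∈ S, (𝒢.rightRegular μ).multiplicity W.toContRep < ⊤) (b : S → ℂ) (T : C → ℂ) {s : ℂ}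
    (h : HasSum (fun W : S => b W * T (p W)) s) :
    HasSum (fun c : C => (∑ W ∈ (finite_fibre_rightRegular hirr horth hspan p hp hfin c).toFinset, b W) * T c) s :=
  hasSum_fibrewise p (finite_fibre_rightRegular hirr horth hspan p hp hfin) b T h

end Adelic

end Summit.HodgeConjecture.HodgeConjecture.Cruxes.H413.K2E1DecompositionSumByClasses

end
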